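import Summits.QuantumFields.BalabanUV.Beta.GAN24.WilsonQuarticChargeOffDiag
import Literature.MathematicalPhysics.QuantumFieldTheory.Balaban1983to89.Beta.WilsonVertex2Sym

/-!
# `BalabanUV.Beta.GAN24.QuarticChargeSymTab` — binder row G-an2-4 ∕ (CONV-C), W-slot road «W3» (SKELETON-W3 v1.0.2 §8.3 ROW W3-F4d ∕ §8.5 (N-F4d)),
# idle-seat kernel lemma (leaf prover `b2b-balaban-gan24-formalise-leaf-14`, gen 24; journal INTENT «W3-F4D-R2*»): **THE (R2) BRANCH OF leaf-18-g17's REPAIR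
# MENU IN THE RECORD CURRENCY — for ANY colour table `Tc` whose quartic Wilson charge is BOND-SYMMETRIC (e.g. an3's Hessian-intrinsic symmetrisation
# `symTab T` of ANY table), ROW W3-F2a at `m = 0` gives `Z(T♮₁ − T♮₀) = (λ₀ − 1)·Z(T♮₀)` EXACTLY, hence ROW W3-F4d's `hZ0` ⟺ `cE₂ = +Lc^{d+5}` (RULINGS-14d AS
# DESIGNED); the charge tensor of `wilsonW₂ d (symTab (w22 N))` in closed form on its nonzero patterns (`−8N²`, `4N²`, `4N²`)**

NOT IN PRINT; OUR BOOKKEEPING (G-an2-4 formalisation swarm; module name PROVISIONAL — the row owner gan24-p1 may rename ∕ re-home it; the F4d holder is the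
leaf-07 lineage, to which this yields).  HONEST FRAMING (cell contract, verbatim): «discharging `BetaPertH` makes Bałaban's UV stability UNCONDITIONAL — a real
constructive-QFT result; it is NOT the continuum limit and NOT the Clay problem.»  HONEST DEPENDENCY (verbatim): «continuum YM on T⁴ ⇐ BetaPertH ∧ nine spine
estimates (0/9 proved); BetaPertH ⇐ (D1) ∧ (D4) ∧ CAP+tail; G-an2-4 gates asym, D1 and NE2/3/4.»

CONTEXT.  leaf-18-g17's `ChargeStepSym.zmode_succ_eq` (the linear part `𝒜_j` acts on the field–field charge tensor by `λ₀·Sym_{bond}`, `λ₀ = cE₂·Lc^{−(d+5)}`) and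
`WilsonQuarticChargeOffDiag.not_hZ0_of_hZb0_w22` (at an3's ORDERED colour-traced table `Tc := w22 N` the charge `Z₄ = 2N²(δ_{κβ}δ_{κ′α} − δ_{κκ′}δ_{αβ})` is NOT
bond-symmetric, so ROW W3-F2a at `m = 0` EXCLUDES ROW W3-F4d's `hZ0` for every `cE₂ ≠ 0`) leave the owner three repairs: (R1) unroll END #2 from `D₁`, (R2) a
bond-symmetric table of record, (R3′) `Zfree := ZfreeSym` (leaf-12-g21).  THIS FILE is the kernel certificate of (R2): no END re-cut, no currency change.
* §1 THE TABLE CALCULUS OF THE CHARGE FUNCTIONAL `Z(T)(κ,κ′;α,β) := Σ'_{u′xz} wilsonW₂ d T κ u κ′ u′ x z (inl α) (inl β)` through leaf-18-g16's frame functional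
  `WilsonQuarticCharge.tsum_wilsonW₂_ff_eq` (finite re-indexing only; generic `d`, ANY table): `tsum_wilsonW₂_ff_swapKL` (background-slot swap = bond swap),
  `tsum_wilsonW₂_ff_swapIJ` (fluctuation-slot swap = fibre swap), `tsum_wilsonW₂_ff_add`, `tsum_wilsonW₂_ff_symTab` (four terms), and
  **`tsum_wilsonW₂_ff_symTab_bond_symm`** ∕ `_leg_symm`: the charge of `wilsonW₂ d (symTab T)` (an3's `WilsonVertex2Sym.symTab`, «only `V(p₁,p₂)+V(p₂,p₁)` is
  intrinsic to the Hessian») is bond- and fibre-symmetric FOR EVERY `T`.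
* §2 VALUES at `symTab (w22 N)` from leaf-18's three values BY NAME (`…_diag_offdiag = −2N²`, `…_cross = 2N²`, `…_par = 0`):
  `(κ,κ;α,α) ↦ −8N²`, `(κ,κ′;κ′,κ) ↦ 4N²`, `(κ,κ′;κ,κ′) ↦ 4N²` (`κ ≠ ·`), i.e. `Z₄(symTab (w22 N)) = 4N²(δ_{κβ}δ_{κ′α} + δ_{κα}δ_{κ′β} − 2δ_{κκ′}δ_{αβ})` on its nonzero
  patterns (an independent exact count of all `4⁴` components, d = 1,2,3: `HOME/…/leaf-14/g24/z4count/Z4-ENGINE2.md`), and `≠ 0`.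
* §3 THE (R2) DICHOTOMY (generic `d`, `Lc ≥ 1`, mixed table with `hmix` ∕ `hmixt`, colour constants symbolic): for ANY `Tc` with bond-symmetric charge, ROW W3-F2a at
  `m = 0` (record cell form) ⟹ **`zmode_firstDiff_eq_of_bond_symm`**: `zmode Lc (T♮₁ − T♮₀) (μ,ν;α,β) = (cE₂·(Lc^{d+5})⁻¹ − 1) · zmode Lc T♮₀ (μ,ν;α,β)`; hence
  **`hZ0_of_pinEq_of_bond_symm`** (the exact pin gives `hZ0`'s charge conjunct) and, if some component of `Z₄(Tc)` is nonzero and `cE₂ ≠ 0`,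
  **`hZ0_iff_pinEq_of_bond_symm`**: `hZ0` ⟺ `cE₂ = Lc^{d+5}`; instances **`hZ0_of_pinEq_symTab`** (ANY `T`), **`hZ0_iff_pinEq_symTab_w22`** (`Tc := symTab (w22 Nc)`,
  `1 ≤ d`, `Nc ≠ 0`) and the `d = 3` form with ref2's pin text `cE₂ = (Lc:ℝ)^(2*(3+1))` (w3_amended: `+Lc⁸`).
READING (docstring level; asserted nowhere): with `Tc := symTab (w22 N)` (or `¼·symTab`, one `wilsonW₂_smul` away) the §8.3 rows AS CUT are jointly satisfiable at
the exact pin and ONLY there — the `Tc`-of-record question (journal l.10060) is an2∕an3's (D1)-identification call, not decided here.  [folklore] finite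
re-indexing + `ring` over tree theorems BY NAME (leaf-18 `ChargeStepSym` ∕ `WilsonQuarticCharge(OffDiag)`, leaf-07 `WSlotFirstDiff.zmode_sub` ∕ `shape_pair`, leaf-19
`T2SlotCovariance.T2diff_translate`, an3 `WilsonVertex2Sym`); asserts NO shape or rate of Bałaban's tables; conditional on F2a₀ (OPEN); 0 `def`, 0 cite, 0
`def … : Prop`, 0 sorry, 0 wall binders instantiated; NOTHING of «T2Shape» ∕ «T2SupRate» ∕ «T2Drift» ∕ (hW, hWall) discharged; `hpin` undischarged; NOT «W-slot
closed», NEVER «G-an2-4 closed»; NOT (CONV-C); NOT BetaPertH, NOT continuum, NOT Clay.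
-/

noncomputable section

open Finset
open scoped BigOperators
open Literature.MathematicalPhysics.QuantumFieldTheory
open Literature.MathematicalPhysics.QuantumFieldTheory.Balaban1983to89
open Literature.MathematicalPhysics.QuantumFieldTheory.Balaban1983to89.Beta
open ExpKernelCalculus (MKer shiftK)
open OneStepResolventKernel (Fib)
open OneStepKernelFamily (KInvStep)
open StepJetData (mfNeg)
open SecondOrderResponse (LocStencilFM W2SymOfK)
open BalabanStepJetsSucc (mmRead)
open BalabanStepW2 (K3OfK Spure M1 M2Of T2Of)
open AveragingMixedJetTables (vh₂S)
open PlaquetteVertex2Stencil (dir)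
open PlaquetteVertex2Trace (w22)
open WilsonBiStencil (wilsonW₂)
open WilsonVertex2Sym (swapIJ swapKL symTab symTab_eq_add swapKL_symTab swapIJ_symTab)
open Summit.QuantumFields.BalabanUV.Beta.HessKerDressedUnits (unitK unitS)
open Summit.QuantumFields.BalabanUV.Beta.SecondOrderUnits (unitM unitS₂ unitM₂)
open Summit.QuantumFields.BalabanUV.Beta.GAN24.CombesThomas (sfStep smStep)
open Summit.QuantumFields.BalabanUV.Beta.GAN24.BiStencilZeroMode (Tab zmode)
open Summit.QuantumFields.BalabanUV.Beta.GAN24.T2SlotCovariance (T2diff_translate)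
open Summit.QuantumFields.BalabanUV.Beta.GAN24.WSlotFirstDiff (zmode_sub shape_pair)
open Summit.QuantumFields.BalabanUV.Beta.GAN24.WilsonQuarticCharge (tsum_wilsonW₂_ff_eq tsum_wilsonW₂_w22_ff_diag_offdiag)
open Summit.QuantumFields.BalabanUV.Beta.GAN24.WilsonQuarticChargeOffDiag (tsum_wilsonW₂_w22_ff_cross tsum_wilsonW₂_w22_ff_par)
open Summit.QuantumFields.BalabanUV.Beta.GAN24.ChargeStepSym (zmode_succ_eq zmode_member_zero)

namespace Summit.QuantumFields.BalabanUV.Beta.GAN24.QuarticChargeSymTab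

variable {d : ℕ}

/-! ## §1 The table calculus of the charge functional (finite re-indexing of the frame functional) -/

section Calculus

variable (T T' : Fin 4 → Fin 4 → Fin 4 → Fin 4 → ℝ)

/-- [folklore] commuting the two conjuncts of an `if` condition (an3's `WilsonVertex2Sym.ite_and_comm`, restated privately at `b := 0`). -/
private theorem ite_and_comm₀ (P Q : Prop) [Decidable P] [Decidable Q] (a : ℝ) :
    (if P ∧ Q then a else 0) = if Q ∧ P then a else 0 := by
  by_cases hP : P <;> by_cases hQ : Q <;> simp [hP, hQ]

/-- [folklore] **BACKGROUND-SLOT SWAP = BOND SWAP OF THE CHARGE**: `Z(swapKL T)(κ,κ′;α,β) = Z(T)(κ′,κ;α,β)` (same first-bond site `u`; the charge is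
first-bond-site-free by the frame functional). -/
theorem tsum_wilsonW₂_ff_swapKL (κ : Fin (d + 1)) (u : Fin (d + 1) → ℤ) (κ' α β : Fin (d + 1)) :
    ∑' u' : Fin (d + 1) → ℤ, ∑' x : Fin (d + 1) → ℤ, ∑' z : Fin (d + 1) → ℤ,
        wilsonW₂ d (swapKL T) κ u κ' u' x z (Sum.inl α) (Sum.inl β)
      = ∑' u' : Fin (d + 1) → ℤ, ∑' x : Fin (d + 1) → ℤ, ∑' z : Fin (d + 1) → ℤ,
        wilsonW₂ d T κ' u κ u' x z (Sum.inl α) (Sum.inl β) := by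
  rw [tsum_wilsonW₂_ff_eq, tsum_wilsonW₂_ff_eq]
  refine Finset.sum_congr rfl fun μ _ => Finset.sum_congr rfl fun ν _ => ?_
  conv_lhs => rw [Finset.sum_comm]
  refine Finset.sum_congr rfl fun a _ => Finset.sum_congr rfl fun b _ => ?_
  simp only [swapKL]
  exact ite_and_comm₀ _ _ _

/-- [folklore] **FLUCTUATION-SLOT SWAP = FIBRE SWAP OF THE CHARGE**: `Z(swapIJ T)(κ,κ′;α,β) = Z(T)(κ,κ′;β,α)`. -/
theorem tsum_wilsonW₂_ff_swapIJ (κ : Fin (d + 1)) (u : Fin (d + 1) → ℤ) (κ' α β : Fin (d + 1)) :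
    ∑' u' : Fin (d + 1) → ℤ, ∑' x : Fin (d + 1) → ℤ, ∑' z : Fin (d + 1) → ℤ,
        wilsonW₂ d (swapIJ T) κ u κ' u' x z (Sum.inl α) (Sum.inl β)
      = ∑' u' : Fin (d + 1) → ℤ, ∑' x : Fin (d + 1) → ℤ, ∑' z : Fin (d + 1) → ℤ,
        wilsonW₂ d T κ u κ' u' x z (Sum.inl β) (Sum.inl α) := by
  rw [tsum_wilsonW₂_ff_eq, tsum_wilsonW₂_ff_eq]
  refine Finset.sum_congr rfl fun μ _ => Finset.sum_congr rfl fun ν _ =>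
    Finset.sum_congr rfl fun k _ => Finset.sum_congr rfl fun l _ => ?_
  split_ifs with h
  · conv_lhs => rw [Finset.sum_comm]
    refine Finset.sum_congr rfl fun a _ => Finset.sum_congr rfl fun b _ => ?_
    simp only [swapIJ]
    exact ite_and_comm₀ _ _ _
  · rfl

/-- [folklore] **THE CHARGE IS ADDITIVE IN THE TABLE**: `Z(T + T′) = Z(T) + Z(T′)`. -/
theorem tsum_wilsonW₂_ff_add (κ : Fin (d + 1)) (u : Fin (d + 1) → ℤ) (κ' α β : Fin (d + 1)) :
    ∑' u' : Fin (d + 1) → ℤ, ∑' x : Fin (d + 1) → ℤ, ∑' z : Fin (d + 1) → ℤ,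
        wilsonW₂ d (T + T') κ u κ' u' x z (Sum.inl α) (Sum.inl β)
      = (∑' u' : Fin (d + 1) → ℤ, ∑' x : Fin (d + 1) → ℤ, ∑' z : Fin (d + 1) → ℤ,
          wilsonW₂ d T κ u κ' u' x z (Sum.inl α) (Sum.inl β))
        + ∑' u' : Fin (d + 1) → ℤ, ∑' x : Fin (d + 1) → ℤ, ∑' z : Fin (d + 1) → ℤ,
          wilsonW₂ d T' κ u κ' u' x z (Sum.inl α) (Sum.inl β) := by
  rw [tsum_wilsonW₂_ff_eq, tsum_wilsonW₂_ff_eq, tsum_wilsonW₂_ff_eq, ← Finset.sum_add_distrib]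
  refine Finset.sum_congr rfl fun μ _ => ?_
  rw [← Finset.sum_add_distrib]
  refine Finset.sum_congr rfl fun ν _ => ?_
  rw [← Finset.sum_add_distrib]
  refine Finset.sum_congr rfl fun k _ => ?_
  rw [← Finset.sum_add_distrib]
  refine Finset.sum_congr rfl fun l _ => ?_
  split_ifs with h
  · rw [← Finset.sum_add_distrib]
    refine Finset.sum_congr rfl fun i _ => ?_
    rw [← Finset.sum_add_distrib]
    refine Finset.sum_congr rfl fun j _ => ?_
    split_ifs with h'
    · rfl
    · rw [add_zero]
  · rw [add_zero]

/-- [folklore] **THE CHARGE OF THE SYMMETRISED TABLE IS THE FOUR-TERM SYMMETRISATION OF THE CHARGE**: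
`Z(symTab T)(κ,κ′;α,β) = Z(T)(κ,κ′;α,β) + Z(T)(κ,κ′;β,α) + Z(T)(κ′,κ;α,β) + Z(T)(κ′,κ;β,α)` (an3's `symTab_eq_add`). -/
theorem tsum_wilsonW₂_ff_symTab (κ : Fin (d + 1)) (u : Fin (d + 1) → ℤ) (κ' α β : Fin (d + 1)) :
    ∑' u' : Fin (d + 1) → ℤ, ∑' x : Fin (d + 1) → ℤ, ∑' z : Fin (d + 1) → ℤ,
        wilsonW₂ d (symTab T) κ u κ' u' x z (Sum.inl α) (Sum.inl β)
      = (∑' u' : Fin (d + 1) → ℤ, ∑' x : Fin (d + 1) → ℤ, ∑' z : Fin (d + 1) → ℤ,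
          wilsonW₂ d T κ u κ' u' x z (Sum.inl α) (Sum.inl β))
        + (∑' u' : Fin (d + 1) → ℤ, ∑' x : Fin (d + 1) → ℤ, ∑' z : Fin (d + 1) → ℤ,
          wilsonW₂ d T κ u κ' u' x z (Sum.inl β) (Sum.inl α))
        + (∑' u' : Fin (d + 1) → ℤ, ∑' x : Fin (d + 1) → ℤ, ∑' z : Fin (d + 1) → ℤ,
          wilsonW₂ d T κ' u κ u' x z (Sum.inl α) (Sum.inl β))
        + ∑' u' : Fin (d + 1) → ℤ, ∑' x : Fin (d + 1) → ℤ, ∑' z : Fin (d + 1) → ℤ,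
          wilsonW₂ d T κ' u κ u' x z (Sum.inl β) (Sum.inl α) := by
  rw [symTab_eq_add, tsum_wilsonW₂_ff_add, tsum_wilsonW₂_ff_add, tsum_wilsonW₂_ff_add, tsum_wilsonW₂_ff_swapIJ,
    tsum_wilsonW₂_ff_swapKL, tsum_wilsonW₂_ff_swapIJ, tsum_wilsonW₂_ff_swapKL]

/-- [folklore] **THE CHARGE OF `wilsonW₂ d (symTab T)` IS BOND-SYMMETRIC, FOR EVERY TABLE `T`**: `Z(symTab T)(κ,κ′;α,β) = Z(symTab T)(κ′,κ;α,β)`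
(`swapKL (symTab T) = symTab T` ⨾ `tsum_wilsonW₂_ff_swapKL`). -/
theorem tsum_wilsonW₂_ff_symTab_bond_symm (κ : Fin (d + 1)) (u : Fin (d + 1) → ℤ) (κ' α β : Fin (d + 1)) :
    ∑' u' : Fin (d + 1) → ℤ, ∑' x : Fin (d + 1) → ℤ, ∑' z : Fin (d + 1) → ℤ,
        wilsonW₂ d (symTab T) κ u κ' u' x z (Sum.inl α) (Sum.inl β)
      = ∑' u' : Fin (d + 1) → ℤ, ∑' x : Fin (d + 1) → ℤ, ∑' z : Fin (d + 1) → ℤ,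
        wilsonW₂ d (symTab T) κ' u κ u' x z (Sum.inl α) (Sum.inl β) := by
  rw [← tsum_wilsonW₂_ff_swapKL (symTab T) κ u κ' α β, swapKL_symTab]

/-- [folklore] **THE CHARGE OF `wilsonW₂ d (symTab T)` IS FIBRE-SYMMETRIC, FOR EVERY TABLE `T`**: `Z(symTab T)(κ,κ′;α,β) = Z(symTab T)(κ,κ′;β,α)`. -/
theorem tsum_wilsonW₂_ff_symTab_leg_symm (κ : Fin (d + 1)) (u : Fin (d + 1) → ℤ) (κ' α β : Fin (d + 1)) :
    ∑' u' : Fin (d + 1) → ℤ, ∑' x : Fin (d + 1) → ℤ, ∑' z : Fin (d + 1) → ℤ,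
        wilsonW₂ d (symTab T) κ u κ' u' x z (Sum.inl α) (Sum.inl β)
      = ∑' u' : Fin (d + 1) → ℤ, ∑' x : Fin (d + 1) → ℤ, ∑' z : Fin (d + 1) → ℤ,
        wilsonW₂ d (symTab T) κ u κ' u' x z (Sum.inl β) (Sum.inl α) := by
  rw [← tsum_wilsonW₂_ff_swapIJ (symTab T) κ u κ' α β, swapIJ_symTab]

end Calculus

/-! ## §2 The values at the symmetrised colour-traced table `symTab (w22 N)` -/

section Values

/-- [folklore] **DIAGONAL-BOND PATTERN `(κ,κ;α,α)`, `κ ≠ α`: `Z(symTab (w22 N)) = −8N²`** (four copies of leaf-18-g16's `−2N²`). -/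
theorem tsum_wilsonW₂_symTab_w22_ff_diag_offdiag (N : ℕ) {κ α : Fin (d + 1)} (hκα : κ ≠ α) (u : Fin (d + 1) → ℤ) :
    ∑' u' : Fin (d + 1) → ℤ, ∑' x : Fin (d + 1) → ℤ, ∑' z : Fin (d + 1) → ℤ,
        wilsonW₂ d (symTab (w22 N)) κ u κ u' x z (Sum.inl α) (Sum.inl α) = -8 * (N : ℝ) ^ 2 := by
  rw [tsum_wilsonW₂_ff_symTab, tsum_wilsonW₂_w22_ff_diag_offdiag N hκα u]
  ring

/-- [folklore] **CROSSED PATTERN `(κ,κ′;κ′,κ)`, `κ ≠ κ′`: `Z(symTab (w22 N)) = 4N²`** (leaf-18-g17's crossed `2N²` twice, parallel `0` twice). -/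
theorem tsum_wilsonW₂_symTab_w22_ff_cross (N : ℕ) {κ κ' : Fin (d + 1)} (hκ : κ ≠ κ') (u : Fin (d + 1) → ℤ) :
    ∑' u' : Fin (d + 1) → ℤ, ∑' x : Fin (d + 1) → ℤ, ∑' z : Fin (d + 1) → ℤ,
        wilsonW₂ d (symTab (w22 N)) κ u κ' u' x z (Sum.inl κ') (Sum.inl κ) = 4 * (N : ℝ) ^ 2 := by
  rw [tsum_wilsonW₂_ff_symTab, tsum_wilsonW₂_w22_ff_cross N hκ u, tsum_wilsonW₂_w22_ff_par N hκ u,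
    tsum_wilsonW₂_w22_ff_par N hκ.symm u, tsum_wilsonW₂_w22_ff_cross N hκ.symm u]
  ring

/-- [folklore] **PARALLEL PATTERN `(κ,κ′;κ,κ′)`, `κ ≠ κ′`: `Z(symTab (w22 N)) = 4N²`** (the symmetrised charge is fibre-symmetric: crossed = parallel). -/
theorem tsum_wilsonW₂_symTab_w22_ff_par (N : ℕ) {κ κ' : Fin (d + 1)} (hκ : κ ≠ κ') (u : Fin (d + 1) → ℤ) :
    ∑' u' : Fin (d + 1) → ℤ, ∑' x : Fin (d + 1) → ℤ, ∑' z : Fin (d + 1) → ℤ,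
        wilsonW₂ d (symTab (w22 N)) κ u κ' u' x z (Sum.inl κ) (Sum.inl κ') = 4 * (N : ℝ) ^ 2 := by
  rw [tsum_wilsonW₂_ff_symTab, tsum_wilsonW₂_w22_ff_par N hκ u, tsum_wilsonW₂_w22_ff_cross N hκ u,
    tsum_wilsonW₂_w22_ff_cross N hκ.symm u, tsum_wilsonW₂_w22_ff_par N hκ.symm u]
  ring

/-- [folklore] **THE SYMMETRISED QUARTIC WILSON CHARGE DOES NOT VANISH** (`N ≠ 0` colours, two distinct directions `κ ≠ α`). -/
theorem tsum_wilsonW₂_symTab_w22_ff_ne_zero {N : ℕ} (hN : N ≠ 0) {κ α : Fin (d + 1)} (hκα : κ ≠ α) (u : Fin (d + 1) → ℤ) :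
    ∑' u' : Fin (d + 1) → ℤ, ∑' x : Fin (d + 1) → ℤ, ∑' z : Fin (d + 1) → ℤ,
        wilsonW₂ d (symTab (w22 N)) κ u κ u' x z (Sum.inl α) (Sum.inl α) ≠ 0 := by
  rw [tsum_wilsonW₂_symTab_w22_ff_diag_offdiag N hκα u]
  have hN' : (N : ℝ) ≠ 0 := Nat.cast_ne_zero.mpr hN
  exact mul_ne_zero (by norm_num) (pow_ne_zero 2 hN')

end Values

/-! ## §3 The (R2) dichotomy: bond-symmetric charge ⟹ `Z(T♮₁ − T♮₀) = (λ₀ − 1)·Z(T♮₀)`, hence `hZ0 ⟺ cE₂ = Lc^{d+5}` -/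

section Dichotomy

variable {Lc : ℕ} [NeZero Lc]

/-- **THE FIRST-DIFFERENCE CHARGE FOR A TABLE WITH BOND-SYMMETRIC QUARTIC CHARGE** [folklore composition of tree theorems]: for an2's normalised Stage-B
family (literal §8.3 texts; generic `d`, `Lc ≥ 1`; mixed table with shape `hmix` and block covariance `hmixt`), ANY colour table `Tc` whose charge tensor
`Z₄(Tc)(μ,ν;α,β) := Σ'_{u′xz} wilsonW₂ d Tc μ 0 ν u′ x z (inl α)(inl β)` is symmetric under `μ ↔ ν`, and ROW W3-F2a at `m = 0` in the record cell form
(`zmode Lc b♮₀ ≡ 0` on the field–field slots):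
`zmode Lc (T♮₁ − T♮₀) (μ,ν;α,β) = (cE₂·(Lc^{d+5})⁻¹ − 1) · zmode Lc T♮₀ (μ,ν;α,β)` — leaf-07's `zmode_sub`, leaf-18's `zmode_succ_eq` (`𝒜₀` acts by
`λ₀·Sym_{bond}`, here `= λ₀` on a symmetric tensor) and `zmode_member_zero`. -/
theorem zmode_firstDiff_eq_of_bond_symm (hLc : 1 ≤ Lc) (cE cVH cΛ cE₂ cB : ℝ) (Tc : Fin 4 → Fin 4 → Fin 4 → Fin 4 → ℝ)
    {mixFF : Tab d} (hmix : ∃ C δ : ℝ, 0 < δ ∧ LocStencilFM Lc mixFF C δ)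
    (hmixt : ∀ (κ : Fin (d + 1)) (u : Fin (d + 1) → ℤ) (ρ : Fin (d + 1)) (w t : Fin (d + 1) → ℤ),
      mixFF κ (u + (Lc : ℤ) • t) ρ (w + t) = shiftK (-((Lc : ℤ) • t)) (mixFF κ u ρ w))
    (hsym : ∀ μ ν α β : Fin (d + 1),
      (∑' u' : Fin (d + 1) → ℤ, ∑' x : Fin (d + 1) → ℤ, ∑' z : Fin (d + 1) → ℤ, wilsonW₂ d Tc μ 0 ν u' x z (Sum.inl α) (Sum.inl β))
        = ∑' u' : Fin (d + 1) → ℤ, ∑' x : Fin (d + 1) → ℤ, ∑' z : Fin (d + 1) → ℤ, wilsonW₂ d Tc ν 0 μ u' x z (Sum.inl α) (Sum.inl β))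
    (hZb0 : ∀ (μ ν α β : Fin (d + 1)), zmode Lc (fun κ u κ' u' => (cE₂ * (Lc : ℝ) ^ (2 * (d + 1))) • mmRead Lc (K3OfK
            (unitK (sfStep Lc 0) (smStep d Lc 0) (KInvStep (d := d) Lc 0)) Lc (unitS (sfStep Lc 0) (smStep d Lc 0) (Spure d Lc cE cVH cΛ 0))
            (unitM (sfStep Lc 0) (smStep d Lc 0) (M1 d Lc cΛ 0)) (W2SymOfK (unitK (sfStep Lc 0) (smStep d Lc 0) (KInvStep (d := d) Lc 0)) Lc
            (unitS (sfStep Lc 0) (smStep d Lc 0) (Spure d Lc cE cVH cΛ 0)) (unitM (sfStep Lc 0) (smStep d Lc 0) (M1 d Lc cΛ 0)) 0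
            (unitM₂ (sfStep Lc 0) (smStep d Lc 0) (M2Of d Lc mixFF 0))) κ u κ' u') + cB • mfNeg ((vh₂S d Lc) κ u κ' u'))
        μ ν (Sum.inl α) (Sum.inl β) = 0)
    (μ ν α β : Fin (d + 1)) :
    zmode Lc (fun κ u κ' u' =>
        unitS₂ (sfStep Lc 1) (smStep d Lc 1) (T2Of d Lc cE cVH cΛ cE₂ cB Tc (vh₂S d Lc) mixFF 1) κ u κ' u'
          - unitS₂ (sfStep Lc 0) (smStep d Lc 0) (T2Of d Lc cE cVH cΛ cE₂ cB Tc (vh₂S d Lc) mixFF 0) κ u κ' u') μ ν (Sum.inl α) (Sum.inl β)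
      = (cE₂ * ((Lc : ℝ) ^ (d + 5))⁻¹ - 1)
          * zmode Lc (unitS₂ (sfStep Lc 0) (smStep d Lc 0) (T2Of d Lc cE cVH cΛ cE₂ cB Tc (vh₂S d Lc) mixFF 0)) μ ν (Sum.inl α) (Sum.inl β) := by
  obtain ⟨C₀, C₁, δ₀, hδ₀, -, -, h₀, h₁⟩ := shape_pair hLc cE cVH cΛ cE₂ cB Tc hmix
  have hL : (Lc : ℝ) ≠ 0 := Nat.cast_ne_zero.mpr (NeZero.ne Lc)
  have hpow : ((Lc : ℝ) ^ (d + 1)) * ((cE₂ * (Lc : ℝ) ^ (2 * (d + 1))) * ((1 / 2 : ℝ) * (((Lc : ℝ) ^ (d + 1 + 1))⁻¹) ^ 4)) * 2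
      = cE₂ * ((Lc : ℝ) ^ (d + 5))⁻¹ := by
    field_simp
    ring
  rw [zmode_sub h₁ h₀ hδ₀ μ ν, zmode_succ_eq hLc Lc cE cVH cΛ cE₂ cB Tc hmix hmixt 0 μ ν α β, hZb0, zero_add,
    zmode_member_zero Lc cE cVH cΛ cE₂ cB Tc mixFF μ ν α β, zmode_member_zero Lc cE cVH cΛ cE₂ cB Tc mixFF ν μ α β, ← hsym μ ν α β, ← hpow]
  ring

/-- **AT THE EXACT PIN, `hZ0` HOLDS FOR EVERY TABLE WITH BOND-SYMMETRIC CHARGE** [folklore]: `cE₂ = Lc^{d+5}` (`λ₀ = 1`), ROW W3-F2a at `m = 0` ⟹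
`zmode Lc (T♮₁ − T♮₀) ≡ 0` on the field–field slots (the zmode conjunct of the `Zfree` of record for `D₀`). -/
theorem hZ0_of_pinEq_of_bond_symm (hLc : 1 ≤ Lc) (cE cVH cΛ cE₂ cB : ℝ) (Tc : Fin 4 → Fin 4 → Fin 4 → Fin 4 → ℝ)
    {mixFF : Tab d} (hmix : ∃ C δ : ℝ, 0 < δ ∧ LocStencilFM Lc mixFF C δ)
    (hmixt : ∀ (κ : Fin (d + 1)) (u : Fin (d + 1) → ℤ) (ρ : Fin (d + 1)) (w t : Fin (d + 1) → ℤ),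
      mixFF κ (u + (Lc : ℤ) • t) ρ (w + t) = shiftK (-((Lc : ℤ) • t)) (mixFF κ u ρ w))
    (hsym : ∀ μ ν α β : Fin (d + 1),
      (∑' u' : Fin (d + 1) → ℤ, ∑' x : Fin (d + 1) → ℤ, ∑' z : Fin (d + 1) → ℤ, wilsonW₂ d Tc μ 0 ν u' x z (Sum.inl α) (Sum.inl β))
        = ∑' u' : Fin (d + 1) → ℤ, ∑' x : Fin (d + 1) → ℤ, ∑' z : Fin (d + 1) → ℤ, wilsonW₂ d Tc ν 0 μ u' x z (Sum.inl α) (Sum.inl β))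
    (hpinEq : cE₂ = (Lc : ℝ) ^ (d + 5))
    (hZb0 : ∀ (μ ν α β : Fin (d + 1)), zmode Lc (fun κ u κ' u' => (cE₂ * (Lc : ℝ) ^ (2 * (d + 1))) • mmRead Lc (K3OfK
            (unitK (sfStep Lc 0) (smStep d Lc 0) (KInvStep (d := d) Lc 0)) Lc (unitS (sfStep Lc 0) (smStep d Lc 0) (Spure d Lc cE cVH cΛ 0))
            (unitM (sfStep Lc 0) (smStep d Lc 0) (M1 d Lc cΛ 0)) (W2SymOfK (unitK (sfStep Lc 0) (smStep d Lc 0) (KInvStep (d := d) Lc 0)) Lc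
            (unitS (sfStep Lc 0) (smStep d Lc 0) (Spure d Lc cE cVH cΛ 0)) (unitM (sfStep Lc 0) (smStep d Lc 0) (M1 d Lc cΛ 0)) 0
            (unitM₂ (sfStep Lc 0) (smStep d Lc 0) (M2Of d Lc mixFF 0))) κ u κ' u') + cB • mfNeg ((vh₂S d Lc) κ u κ' u'))
        μ ν (Sum.inl α) (Sum.inl β) = 0)
    (μ ν α β : Fin (d + 1)) :
    zmode Lc (fun κ u κ' u' =>
        unitS₂ (sfStep Lc 1) (smStep d Lc 1) (T2Of d Lc cE cVH cΛ cE₂ cB Tc (vh₂S d Lc) mixFF 1) κ u κ' u'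
          - unitS₂ (sfStep Lc 0) (smStep d Lc 0) (T2Of d Lc cE cVH cΛ cE₂ cB Tc (vh₂S d Lc) mixFF 0) κ u κ' u') μ ν (Sum.inl α) (Sum.inl β) = 0 := by
  have hL : (Lc : ℝ) ^ (d + 5) ≠ 0 := pow_ne_zero _ (Nat.cast_ne_zero.mpr (NeZero.ne Lc))
  rw [zmode_firstDiff_eq_of_bond_symm hLc cE cVH cΛ cE₂ cB Tc hmix hmixt hsym hZb0 μ ν α β, hpinEq, mul_inv_cancel₀ hL, sub_self, zero_mul]

/-- **THE (R2) DICHOTOMY: `hZ0 ⟺ cE₂ = Lc^{d+5}`** [folklore]: for ANY table `Tc` whose quartic charge is bond-symmetric and has SOME nonzero component,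
`cE₂ ≠ 0`, ROW W3-F2a at `m = 0` (record cell form): the zmode conjunct of ROW W3-F4d's `hZ0` holds IFF the pin is exact — RULINGS-14d ∕ (N-F4d) «`hZ0 ⟺ λ = 1`»
AS DESIGNED, with the sign `+` (`λ₀ = cE₂·Lc^{−(d+5)}`). -/
theorem hZ0_iff_pinEq_of_bond_symm (hLc : 1 ≤ Lc) (cE cVH cΛ cE₂ cB : ℝ) (Tc : Fin 4 → Fin 4 → Fin 4 → Fin 4 → ℝ)
    {mixFF : Tab d} (hmix : ∃ C δ : ℝ, 0 < δ ∧ LocStencilFM Lc mixFF C δ)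
    (hmixt : ∀ (κ : Fin (d + 1)) (u : Fin (d + 1) → ℤ) (ρ : Fin (d + 1)) (w t : Fin (d + 1) → ℤ),
      mixFF κ (u + (Lc : ℤ) • t) ρ (w + t) = shiftK (-((Lc : ℤ) • t)) (mixFF κ u ρ w))
    (hsym : ∀ μ ν α β : Fin (d + 1),
      (∑' u' : Fin (d + 1) → ℤ, ∑' x : Fin (d + 1) → ℤ, ∑' z : Fin (d + 1) → ℤ, wilsonW₂ d Tc μ 0 ν u' x z (Sum.inl α) (Sum.inl β))
        = ∑' u' : Fin (d + 1) → ℤ, ∑' x : Fin (d + 1) → ℤ, ∑' z : Fin (d + 1) → ℤ, wilsonW₂ d Tc ν 0 μ u' x z (Sum.inl α) (Sum.inl β))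
    (hne : ∃ μ ν α β : Fin (d + 1),
      (∑' u' : Fin (d + 1) → ℤ, ∑' x : Fin (d + 1) → ℤ, ∑' z : Fin (d + 1) → ℤ, wilsonW₂ d Tc μ 0 ν u' x z (Sum.inl α) (Sum.inl β)) ≠ 0)
    (hcE₂ : cE₂ ≠ 0)
    (hZb0 : ∀ (μ ν α β : Fin (d + 1)), zmode Lc (fun κ u κ' u' => (cE₂ * (Lc : ℝ) ^ (2 * (d + 1))) • mmRead Lc (K3OfK
            (unitK (sfStep Lc 0) (smStep d Lc 0) (KInvStep (d := d) Lc 0)) Lc (unitS (sfStep Lc 0) (smStep d Lc 0) (Spure d Lc cE cVH cΛ 0))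
            (unitM (sfStep Lc 0) (smStep d Lc 0) (M1 d Lc cΛ 0)) (W2SymOfK (unitK (sfStep Lc 0) (smStep d Lc 0) (KInvStep (d := d) Lc 0)) Lc
            (unitS (sfStep Lc 0) (smStep d Lc 0) (Spure d Lc cE cVH cΛ 0)) (unitM (sfStep Lc 0) (smStep d Lc 0) (M1 d Lc cΛ 0)) 0
            (unitM₂ (sfStep Lc 0) (smStep d Lc 0) (M2Of d Lc mixFF 0))) κ u κ' u') + cB • mfNeg ((vh₂S d Lc) κ u κ' u'))
        μ ν (Sum.inl α) (Sum.inl β) = 0) :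
    (∀ μ ν α β : Fin (d + 1), zmode Lc (fun κ u κ' u' =>
        unitS₂ (sfStep Lc 1) (smStep d Lc 1) (T2Of d Lc cE cVH cΛ cE₂ cB Tc (vh₂S d Lc) mixFF 1) κ u κ' u'
          - unitS₂ (sfStep Lc 0) (smStep d Lc 0) (T2Of d Lc cE cVH cΛ cE₂ cB Tc (vh₂S d Lc) mixFF 0) κ u κ' u') μ ν (Sum.inl α) (Sum.inl β) = 0)
      ↔ cE₂ = (Lc : ℝ) ^ (d + 5) := by
  have hL : (Lc : ℝ) ^ (d + 5) ≠ 0 := pow_ne_zero _ (Nat.cast_ne_zero.mpr (NeZero.ne Lc))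
  have hL1 : (Lc : ℝ) ^ (d + 1) ≠ 0 := pow_ne_zero _ (Nat.cast_ne_zero.mpr (NeZero.ne Lc))
  refine ⟨fun h => ?_, fun hpinEq μ ν α β => hZ0_of_pinEq_of_bond_symm hLc cE cVH cΛ cE₂ cB Tc hmix hmixt hsym hpinEq hZb0 μ ν α β⟩
  obtain ⟨μ, ν, α, β, hZ⟩ := hne
  have e := zmode_firstDiff_eq_of_bond_symm hLc cE cVH cΛ cE₂ cB Tc hmix hmixt hsym hZb0 μ ν α β
  rw [h μ ν α β, zmode_member_zero Lc cE cVH cΛ cE₂ cB Tc mixFF μ ν α β] at e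
  have hA : cE₂ * (((Lc : ℝ) ^ (d + 1)) *
      ∑' u' : Fin (d + 1) → ℤ, ∑' x : Fin (d + 1) → ℤ, ∑' z : Fin (d + 1) → ℤ,
        wilsonW₂ d Tc μ 0 ν u' x z (Sum.inl α) (Sum.inl β)) ≠ 0 := mul_ne_zero hcE₂ (mul_ne_zero hL1 hZ)
  have h1 : cE₂ * ((Lc : ℝ) ^ (d + 5))⁻¹ - 1 = 0 := (mul_eq_zero.1 e.symm).resolve_right hA
  rwa [sub_eq_zero, mul_inv_eq_one₀ hL] at h1

/-- **INSTANCE (R2): `Tc := symTab T`, ANY `T` — at the exact pin, ROW W3-F2a at `m = 0` gives ROW W3-F4d's `hZ0` IN THE RECORD CURRENCY**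
(both conjuncts: joint `Lc`-covariance of `D₀` by leaf-19's `T2diff_translate`, and the field–field cell charge `≡ 0`). [folklore] -/
theorem hZ0_of_pinEq_symTab (hLc : 1 ≤ Lc) (cE cVH cΛ cE₂ cB : ℝ) (T : Fin 4 → Fin 4 → Fin 4 → Fin 4 → ℝ)
    {mixFF : Tab d} (hmix : ∃ C δ : ℝ, 0 < δ ∧ LocStencilFM Lc mixFF C δ)
    (hmixt : ∀ (κ : Fin (d + 1)) (u : Fin (d + 1) → ℤ) (ρ : Fin (d + 1)) (w t : Fin (d + 1) → ℤ),
      mixFF κ (u + (Lc : ℤ) • t) ρ (w + t) = shiftK (-((Lc : ℤ) • t)) (mixFF κ u ρ w))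
    (hpinEq : cE₂ = (Lc : ℝ) ^ (d + 5))
    (hZb0 : ∀ (μ ν α β : Fin (d + 1)), zmode Lc (fun κ u κ' u' => (cE₂ * (Lc : ℝ) ^ (2 * (d + 1))) • mmRead Lc (K3OfK
            (unitK (sfStep Lc 0) (smStep d Lc 0) (KInvStep (d := d) Lc 0)) Lc (unitS (sfStep Lc 0) (smStep d Lc 0) (Spure d Lc cE cVH cΛ 0))
            (unitM (sfStep Lc 0) (smStep d Lc 0) (M1 d Lc cΛ 0)) (W2SymOfK (unitK (sfStep Lc 0) (smStep d Lc 0) (KInvStep (d := d) Lc 0)) Lc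
            (unitS (sfStep Lc 0) (smStep d Lc 0) (Spure d Lc cE cVH cΛ 0)) (unitM (sfStep Lc 0) (smStep d Lc 0) (M1 d Lc cΛ 0)) 0
            (unitM₂ (sfStep Lc 0) (smStep d Lc 0) (M2Of d Lc mixFF 0))) κ u κ' u') + cB • mfNeg ((vh₂S d Lc) κ u κ' u'))
        μ ν (Sum.inl α) (Sum.inl β) = 0) :
    (∀ (κ : Fin (d + 1)) (u : Fin (d + 1) → ℤ) (κ' : Fin (d + 1)) (u' t : Fin (d + 1) → ℤ), (fun κ u κ' u' =>
        unitS₂ (sfStep Lc 1) (smStep d Lc 1) (T2Of d Lc cE cVH cΛ cE₂ cB (symTab T) (vh₂S d Lc) mixFF 1) κ u κ' u'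
          - unitS₂ (sfStep Lc 0) (smStep d Lc 0) (T2Of d Lc cE cVH cΛ cE₂ cB (symTab T) (vh₂S d Lc) mixFF 0) κ u κ' u')
          κ (u + (Lc : ℤ) • t) κ' (u' + (Lc : ℤ) • t)
        = shiftK (-((Lc : ℤ) • t)) ((fun κ u κ' u' =>
        unitS₂ (sfStep Lc 1) (smStep d Lc 1) (T2Of d Lc cE cVH cΛ cE₂ cB (symTab T) (vh₂S d Lc) mixFF 1) κ u κ' u'
          - unitS₂ (sfStep Lc 0) (smStep d Lc 0) (T2Of d Lc cE cVH cΛ cE₂ cB (symTab T) (vh₂S d Lc) mixFF 0) κ u κ' u') κ u κ' u')) ∧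
      (∀ μ ν α β : Fin (d + 1), zmode Lc (fun κ u κ' u' =>
        unitS₂ (sfStep Lc 1) (smStep d Lc 1) (T2Of d Lc cE cVH cΛ cE₂ cB (symTab T) (vh₂S d Lc) mixFF 1) κ u κ' u'
          - unitS₂ (sfStep Lc 0) (smStep d Lc 0) (T2Of d Lc cE cVH cΛ cE₂ cB (symTab T) (vh₂S d Lc) mixFF 0) κ u κ' u') μ ν (Sum.inl α) (Sum.inl β) = 0) :=
  ⟨fun κ u κ' u' t => T2diff_translate hLc cE cVH cΛ cE₂ cB (symTab T) hmixt 0 κ u κ' u' t,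
    fun μ ν α β => hZ0_of_pinEq_of_bond_symm hLc cE cVH cΛ cE₂ cB (symTab T) hmix hmixt
      (fun μ ν α β => tsum_wilsonW₂_ff_symTab_bond_symm T μ 0 ν α β) hpinEq hZb0 μ ν α β⟩

/-- **INSTANCE (R2) AT THE SYMMETRISED COLOUR-TRACED TABLE `Tc := symTab (w22 Nc)`** (`1 ≤ d`, `Nc ≠ 0` colours, `cE₂ ≠ 0`): given ROW W3-F2a at `m = 0`,
ROW W3-F4d's record-currency `hZ0` (zmode conjunct) ⟺ `cE₂ = Lc^{d+5}`. [folklore] -/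
theorem hZ0_iff_pinEq_symTab_w22 (hLc : 1 ≤ Lc) (hd : 1 ≤ d) {Nc : ℕ} (hNc : Nc ≠ 0) (cE cVH cΛ cE₂ cB : ℝ) (hcE₂ : cE₂ ≠ 0)
    {mixFF : Tab d} (hmix : ∃ C δ : ℝ, 0 < δ ∧ LocStencilFM Lc mixFF C δ)
    (hmixt : ∀ (κ : Fin (d + 1)) (u : Fin (d + 1) → ℤ) (ρ : Fin (d + 1)) (w t : Fin (d + 1) → ℤ),
      mixFF κ (u + (Lc : ℤ) • t) ρ (w + t) = shiftK (-((Lc : ℤ) • t)) (mixFF κ u ρ w))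
    (hZb0 : ∀ (μ ν α β : Fin (d + 1)), zmode Lc (fun κ u κ' u' => (cE₂ * (Lc : ℝ) ^ (2 * (d + 1))) • mmRead Lc (K3OfK
            (unitK (sfStep Lc 0) (smStep d Lc 0) (KInvStep (d := d) Lc 0)) Lc (unitS (sfStep Lc 0) (smStep d Lc 0) (Spure d Lc cE cVH cΛ 0))
            (unitM (sfStep Lc 0) (smStep d Lc 0) (M1 d Lc cΛ 0)) (W2SymOfK (unitK (sfStep Lc 0) (smStep d Lc 0) (KInvStep (d := d) Lc 0)) Lc
            (unitS (sfStep Lc 0) (smStep d Lc 0) (Spure d Lc cE cVH cΛ 0)) (unitM (sfStep Lc 0) (smStep d Lc 0) (M1 d Lc cΛ 0)) 0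
            (unitM₂ (sfStep Lc 0) (smStep d Lc 0) (M2Of d Lc mixFF 0))) κ u κ' u') + cB • mfNeg ((vh₂S d Lc) κ u κ' u'))
        μ ν (Sum.inl α) (Sum.inl β) = 0) :
    (∀ μ ν α β : Fin (d + 1), zmode Lc (fun κ u κ' u' =>
        unitS₂ (sfStep Lc 1) (smStep d Lc 1) (T2Of d Lc cE cVH cΛ cE₂ cB (symTab (w22 Nc)) (vh₂S d Lc) mixFF 1) κ u κ' u'
          - unitS₂ (sfStep Lc 0) (smStep d Lc 0) (T2Of d Lc cE cVH cΛ cE₂ cB (symTab (w22 Nc)) (vh₂S d Lc) mixFF 0) κ u κ' u')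
        μ ν (Sum.inl α) (Sum.inl β) = 0)
      ↔ cE₂ = (Lc : ℝ) ^ (d + 5) := by
  refine hZ0_iff_pinEq_of_bond_symm hLc cE cVH cΛ cE₂ cB (symTab (w22 Nc)) hmix hmixt
    (fun μ ν α β => tsum_wilsonW₂_ff_symTab_bond_symm (w22 Nc) μ 0 ν α β) ?_ hcE₂ hZb0
  refine ⟨⟨0, by omega⟩, ⟨0, by omega⟩, ⟨1, by omega⟩, ⟨1, by omega⟩, ?_⟩
  exact tsum_wilsonW₂_symTab_w22_ff_ne_zero hNc (fun h => by simp [Fin.ext_iff] at h) 0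

/-- **`d = 3` WITH ref2's PIN TEXT** (w3_amended: `+Lc⁸`): at `Tc := symTab (w22 Nc)`, `Nc ≠ 0`, `cE₂ ≠ 0`, `Lc ≥ 1`, given ROW W3-F2a at `m = 0`,
ROW W3-F4d's record-currency `hZ0` (zmode conjunct) ⟺ `cE₂ = (Lc:ℝ)^(2*(3+1))`. [folklore] -/
theorem hZ0_iff_pinEq_symTab_w22_three (hLc : 1 ≤ Lc) {Nc : ℕ} (hNc : Nc ≠ 0) (cE cVH cΛ cE₂ cB : ℝ) (hcE₂ : cE₂ ≠ 0)
    {mixFF : Tab 3} (hmix : ∃ C δ : ℝ, 0 < δ ∧ LocStencilFM Lc mixFF C δ)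
    (hmixt : ∀ (κ : Fin (3 + 1)) (u : Fin (3 + 1) → ℤ) (ρ : Fin (3 + 1)) (w t : Fin (3 + 1) → ℤ),
      mixFF κ (u + (Lc : ℤ) • t) ρ (w + t) = shiftK (-((Lc : ℤ) • t)) (mixFF κ u ρ w))
    (hZb0 : ∀ (μ ν α β : Fin (3 + 1)), zmode Lc (fun κ u κ' u' => (cE₂ * (Lc : ℝ) ^ (2 * (3 + 1))) • mmRead Lc (K3OfK
            (unitK (sfStep Lc 0) (smStep 3 Lc 0) (KInvStep (d := 3) Lc 0)) Lc (unitS (sfStep Lc 0) (smStep 3 Lc 0) (Spure 3 Lc cE cVH cΛ 0))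
            (unitM (sfStep Lc 0) (smStep 3 Lc 0) (M1 3 Lc cΛ 0)) (W2SymOfK (unitK (sfStep Lc 0) (smStep 3 Lc 0) (KInvStep (d := 3) Lc 0)) Lc
            (unitS (sfStep Lc 0) (smStep 3 Lc 0) (Spure 3 Lc cE cVH cΛ 0)) (unitM (sfStep Lc 0) (smStep 3 Lc 0) (M1 3 Lc cΛ 0)) 0
            (unitM₂ (sfStep Lc 0) (smStep 3 Lc 0) (M2Of 3 Lc mixFF 0))) κ u κ' u') + cB • mfNeg ((vh₂S 3 Lc) κ u κ' u'))
        μ ν (Sum.inl α) (Sum.inl β) = 0) :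
    (∀ μ ν α β : Fin (3 + 1), zmode Lc (fun κ u κ' u' =>
        unitS₂ (sfStep Lc 1) (smStep 3 Lc 1) (T2Of 3 Lc cE cVH cΛ cE₂ cB (symTab (w22 Nc)) (vh₂S 3 Lc) mixFF 1) κ u κ' u'
          - unitS₂ (sfStep Lc 0) (smStep 3 Lc 0) (T2Of 3 Lc cE cVH cΛ cE₂ cB (symTab (w22 Nc)) (vh₂S 3 Lc) mixFF 0) κ u κ' u')
        μ ν (Sum.inl α) (Sum.inl β) = 0)
      ↔ cE₂ = (Lc : ℝ) ^ (2 * (3 + 1)) := by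
  have h8 : (Lc : ℝ) ^ (2 * (3 + 1)) = (Lc : ℝ) ^ (3 + 5) := by norm_num
  rw [h8]
  exact hZ0_iff_pinEq_symTab_w22 (d := 3) hLc (by norm_num) hNc cE cVH cΛ cE₂ cB hcE₂ hmix hmixt hZb0

end Dichotomy

end Summit.QuantumFields.BalabanUV.Beta.GAN24.QuarticChargeSymTab

end
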